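import Summits.FinalStateConjecture.FinalStateConjecture.Theorems.EIHFluxBalanceInertialRecessionChargeKinematicsPairWindow

/-!
# Route EIHFluxBalance — `InertialRecession`, line `old-light-leaves-the-cone`: charge kinematics,
# XVII (the laws of the escape configuration)

Helper file for the crux `stmt-FinalStateConjecture-10166`
(`Summit.FinalStateConjecture.FinalStateConjecture.Theses.EIHFluxBalance.InertialRecession`), second line
lead, endgame stub `stub_expandingChargeKinematics` (S4: abstract quasi-conserved window charges with the
slack-form window law and the single-hole identification ⇒ Cesàro velocities of the painted centres).
THE ESCAPE SERIES: the endgame for `N = 3` (Case A all-pairs freezing is `ChargeKinematicsAllPairs*`;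
Case B, the escape of a fast hole from a velocity-tight pair, is this series; the assembly is
`ChargeKinematicsThree`).

XVII — THE LAWS OF THE ESCAPE CONFIGURATION (`escape_laws`): the three nearest-neighbour radii
`min(min(d, d')/3, c₂s)` (`radius_of_two_props`) with their singleton laws, and the pair window law of
`{a, c}`; packaging lemma keeping the bootstrap within the elaboration budget.

Every statement is Mathlib-only real analysis over the stub's verbatim hypotheses ([folklore]); the abstract
charge `P` is arbitrary (adversarial), constrained only by the window law and the identification.
-/

set_option linter.dupNamespace false

noncomputable section

open Filter Set Metric Real
open scoped Topology

namespace Summit.FinalStateConjecture.FinalStateConjecture.Theorems.ChargeKinematics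

open Literature.Geometry.Lorentzian

/-! ## The laws of the escape configuration -/

section EscapeLaws

open MeasureTheory intervalIntegral

variable {N : ℕ} {M : Fin N → ℝ} {ξ v : Fin N → ℝ → E3} {κ : ℝ} {P : ℝ → E3 → ℝ → Fin 4 → ℝ}

/-- Pairwise distances of late `2`-Lipschitz centres are `4`-Lipschitz. [folklore] -/
theorem abs_dist_sub_dist_le {ξ₁ ξ₂ : ℝ → E3} {TL s s' : ℝ}
    (h₁ : ∀ s s', TL ≤ s → TL ≤ s' → ‖ξ₁ s - ξ₁ s'‖ ≤ 2 * |s - s'|)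
    (h₂ : ∀ s s', TL ≤ s → TL ≤ s' → ‖ξ₂ s - ξ₂ s'‖ ≤ 2 * |s - s'|) (hs : TL ≤ s) (hs' : TL ≤ s') :
    |‖ξ₁ s - ξ₂ s‖ - ‖ξ₁ s' - ξ₂ s'‖| ≤ 4 * |s - s'| := by
  have h3 : |‖ξ₁ s - ξ₂ s‖ - ‖ξ₁ s' - ξ₂ s'‖| ≤ ‖(ξ₁ s - ξ₂ s) - (ξ₁ s' - ξ₂ s')‖ :=
    abs_norm_sub_norm_le _ _
  have h4 : ‖(ξ₁ s - ξ₂ s) - (ξ₁ s' - ξ₂ s')‖ ≤ ‖ξ₁ s - ξ₁ s'‖ + ‖ξ₂ s - ξ₂ s'‖ := by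
    have : (ξ₁ s - ξ₂ s) - (ξ₁ s' - ξ₂ s') = (ξ₁ s - ξ₁ s') - (ξ₂ s - ξ₂ s') := by abel
    rw [this]; exact norm_sub_le _ _
  linarith [h₁ s s' hs hs', h₂ s s' hs hs']

/-- The nearest-neighbour radius built on two partner distances, `R = min(min(D₁, D₂)/3, c₂ s)`, is
eventually `2`-Lipschitz, below the cone rate, and tends to `+∞`. [folklore] -/
theorem radius_of_two_props {D₁ D₂ R : ℝ → ℝ} {TL c₂ κ : ℝ} (hTL0 : 0 ≤ TL) (hc₂ : 0 < c₂)
    (hc₂κ : c₂ ≤ (κ - κ ^ 2) / 2) (hc₂1 : c₂ ≤ 1)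
    (hR : ∀ s, R s = min (min (D₁ s) (D₂ s) / 3) (c₂ * s))
    (h₁ : ∀ s s', TL ≤ s → TL ≤ s' → |D₁ s - D₁ s'| ≤ 4 * |s - s'|)
    (h₂ : ∀ s s', TL ≤ s → TL ≤ s' → |D₂ s - D₂ s'| ≤ 4 * |s - s'|)
    (hi₁ : Tendsto D₁ atTop atTop) (hi₂ : Tendsto D₂ atTop atTop) :
    (∀ s s', TL ≤ s → TL ≤ s' → |R s - R s'| ≤ 2 * |s - s'|) ∧
      (∀ s, TL ≤ s → R s ≤ (κ - κ ^ 2) / 2 * s) ∧ Tendsto R atTop atTop := by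
  refine ⟨fun s s' hs hs' ↦ ?_, fun s hs ↦ ?_, ?_⟩
  · rw [hR, hR]
    refine (abs_min_sub_min_le_max _ _ _ _).trans (max_le ?_ ?_)
    · rw [← sub_div, abs_div, abs_of_pos (by norm_num : (0 : ℝ) < 3),
        div_le_iff₀ (by norm_num : (0 : ℝ) < 3)]
      have := (abs_min_sub_min_le_max _ _ _ _).trans (max_le (h₁ s s' hs hs') (h₂ s s' hs hs'))
      linarith [abs_nonneg (s - s')]
    · rw [← mul_sub, abs_mul, abs_of_pos hc₂]
      exact mul_le_mul_of_nonneg_right (by linarith) (abs_nonneg _)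
  · rw [hR]
    have hs0 : 0 ≤ s := hTL0.trans hs
    exact (min_le_right _ _).trans (by nlinarith)
  · rw [Filter.tendsto_atTop]
    intro b
    filter_upwards [(hi₁.atTop_div_const (by norm_num : (0 : ℝ) < 3)).eventually_ge_atTop b,
      (hi₂.atTop_div_const (by norm_num : (0 : ℝ) < 3)).eventually_ge_atTop b,
      (tendsto_id.const_mul_atTop hc₂).eventually_ge_atTop b] with s h1 h2 h3
    rw [hR]
    refine le_min ?_ h3
    rw [← min_div_div_right (by norm_num : (0 : ℝ) ≤ 3)]
    exact le_min h1 h2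

/-- **The laws of the escape configuration.** For three holes `a, b, c` (all holes), the three
nearest-neighbour radii `min(min(d, d')/3, c₂s)` carry singleton laws (one constant, one threshold, one
error each) and the pair `{a, c}` carries the pair window law along any clearance function
(`pair_window_law`). Packaging lemma (keeps the escape bootstrap within the elaboration budget).
[folklore] -/
theorem escape_laws (hκ0 : 0 < κ) (hκ1 : κ < 1)
    (hξ : ∀ i, ContDiff ℝ ((⊤ : ℕ∞) : WithTop ℕ∞) (ξ i))
    (hcone : ∀ i, ∀ᶠ t in atTop, ‖ξ i t‖ ≤ κ ^ 2 * t)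
    (hsep : ∀ i j, i ≠ j → Tendsto (fun t ↦ ‖ξ i t - ξ j t‖) atTop atTop)
    (hk : ∃ k : ℝ, 0 ≤ k ∧ k < 1 ∧ ∀ i, ∀ᶠ t in atTop, ‖v i t‖ ≤ k)
    (hslave : ∀ i, Tendsto (fun t ↦ deriv (ξ i) t - v i t) atTop (𝓝 0))
    (hW : ∀ δ : ℝ, 0 < δ → δ < 1 → ∃ (C R₀ T : ℝ) (η : ℝ → ℝ), Tendsto η atTop (𝓝 0) ∧ ∀ (t₁ t₂ : ℝ) (c : ℝ → E3) (R : ℝ → ℝ), T ≤ t₁ → t₁ ≤ t₂ → (∀ s ∈ Set.Icc t₁ t₂, ∀ s' ∈ Set.Icc t₁ t₂, ‖c s - c s'‖ ≤ 2 * |s - s'| ∧ |R s - R s'| ≤ 2 * |s - s'|) → (∀ s ∈ Set.Icc t₁ t₂, (R₀ ≤ R s ∧ ‖c s‖ + R s ≤ (κ + κ ^ 2) / 2 * s ∧ ∀ j, ‖ξ j s - c s‖ ≤ (1 - δ) * R s ∨ (1 + δ) * R s ≤ ‖ξ j s - c s‖)) → ∀ μ : Fin 4, |P t₂ (c t₂)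 (R t₂) μ - P t₁ (c t₁) (R t₁) μ| ≤ C * (∫ s in t₁..t₂, ((R s) ^ 2)⁻¹ + ((R s) ^ (7 / 4 : ℝ))⁻¹) + η t₁)
    (hI : ∃ (C R₀ T : ℝ) (ζ : ℝ → ℝ), Tendsto ζ atTop (𝓝 0) ∧ (∀ (t : ℝ) (i : Fin N) (R : ℝ), T ≤ t → R₀ ≤ R → ‖ξ i t‖ + R ≤ (κ + κ ^ 2) / 2 * t → (∀ j, j ≠ i → 3 * R ≤ ‖ξ i t - ξ j t‖) → |P t (ξ i t) R 0 - M i * (√(1 - ‖v i t‖ ^ 2))⁻¹| ≤ ζ t + C / R ∧ ∀ k : Fin 3, |P t (ξ i t) R k.succ - M i * (√(1 - ‖v i t‖ ^ 2))⁻¹ * v i t k| ≤ ζ t + C / R) ∧ (∀ (t : ℝ) (c : E3) (R : ℝ) (A : Finset (Fin N)) (ρ : Fin N → ℝ), T ≤ t → R₀ ≤ R → ‖c‖ + R ≤ (κ + κ ^ 2) / 2 * t → (∀ j ∈ A, ‖ξ j t - c‖ ≤ R / 2) → (∀ j ∉ A, 2 * R ≤ ‖ξ j t - c‖) → (∀ j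 ∈ A, R₀ ≤ ρ j ∧ ρ j ≤ R / 4 ∧ ∀ j', j' ≠ j → 3 * ρ j ≤ ‖ξ j t - ξ j' t‖) → ∀ μ : Fin 4, |P t c R μ - ∑ j ∈ A, P t (ξ j t) (ρ j) μ| ≤ C * (R⁻¹ + ∑ j ∈ A, (ρ j)⁻¹) + ζ t))
    {a b c : Fin N} (hab : a ≠ b) (hbc : b ≠ c) (hac : a ≠ c) (h3 : ∀ l, l = a ∨ l = b ∨ l = c)
    {c₂ TL : ℝ} (hc₂ : 0 < c₂) (hc₂κ : c₂ ≤ (κ - κ ^ 2) / 2) (hc₂1 : c₂ ≤ 1) (hTL0 : 0 ≤ TL)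
    (hLip : ∀ i s s', TL ≤ s → TL ≤ s' → ‖ξ i s - ξ i s'‖ ≤ 2 * |s - s'|) :
    ∃ Ra Rb Rc : ℝ → ℝ, (∀ s, Ra s = min (min ‖ξ b s - ξ a s‖ ‖ξ a s - ξ c s‖ / 3) (c₂ * s)) ∧
      (∀ s, Rb s = min (min ‖ξ b s - ξ a s‖ ‖ξ b s - ξ c s‖ / 3) (c₂ * s)) ∧
      (∀ s, Rc s = min (min ‖ξ b s - ξ c s‖ ‖ξ a s - ξ c s‖ / 3) (c₂ * s)) ∧
      (∃ (Ca Ta : ℝ) (ea : ℝ → ℝ), 0 ≤ Ca ∧ Tendsto ea atTop (𝓝 0) ∧ (∀ t, Ta ≤ t → 0 ≤ ea t) ∧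
        (∀ t₁ t₂, Ta ≤ t₁ → t₁ ≤ t₂ → ∀ μ : Fin 4,
          |P t₂ (ξ a t₂) (Ra t₂) μ - P t₁ (ξ a t₁) (Ra t₁) μ| ≤
            Ca * (∫ s in t₁..t₂, ((Ra s) ^ 2)⁻¹ + ((Ra s) ^ (7 / 4 : ℝ))⁻¹) + ea t₁) ∧
        (∀ t, Ta ≤ t → |P t (ξ a t) (Ra t) 0 - M a * (√(1 - ‖v a t‖ ^ 2))⁻¹| ≤ ea t ∧
          ∀ k' : Fin 3, |P t (ξ a t) (Ra t) k'.succ - M a * (√(1 - ‖v a t‖ ^ 2))⁻¹ * v a t k'| ≤ ea t) ∧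
        (∀ t, Ta ≤ t → 1 ≤ Ra t ∧ TL ≤ t)) ∧
      (∃ (Cb Tb : ℝ) (eb : ℝ → ℝ), 0 ≤ Cb ∧ Tendsto eb atTop (𝓝 0) ∧ (∀ t, Tb ≤ t → 0 ≤ eb t) ∧
        (∀ t₁ t₂, Tb ≤ t₁ → t₁ ≤ t₂ → ∀ μ : Fin 4,
          |P t₂ (ξ b t₂) (Rb t₂) μ - P t₁ (ξ b t₁) (Rb t₁) μ| ≤
            Cb * (∫ s in t₁..t₂, ((Rb s) ^ 2)⁻¹ + ((Rb s) ^ (7 / 4 : ℝ))⁻¹) + eb t₁) ∧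
        (∀ t, Tb ≤ t → |P t (ξ b t) (Rb t) 0 - M b * (√(1 - ‖v b t‖ ^ 2))⁻¹| ≤ eb t ∧
          ∀ k' : Fin 3, |P t (ξ b t) (Rb t) k'.succ - M b * (√(1 - ‖v b t‖ ^ 2))⁻¹ * v b t k'| ≤ eb t) ∧
        (∀ t, Tb ≤ t → 1 ≤ Rb t ∧ TL ≤ t)) ∧
      (∃ (Cc Tc : ℝ) (ec : ℝ → ℝ), 0 ≤ Cc ∧ Tendsto ec atTop (𝓝 0) ∧ (∀ t, Tc ≤ t → 0 ≤ ec t) ∧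
        (∀ t₁ t₂, Tc ≤ t₁ → t₁ ≤ t₂ → ∀ μ : Fin 4,
          |P t₂ (ξ c t₂) (Rc t₂) μ - P t₁ (ξ c t₁) (Rc t₁) μ| ≤
            Cc * (∫ s in t₁..t₂, ((Rc s) ^ 2)⁻¹ + ((Rc s) ^ (7 / 4 : ℝ))⁻¹) + ec t₁) ∧
        (∀ t, Tc ≤ t → |P t (ξ c t) (Rc t) 0 - M c * (√(1 - ‖v c t‖ ^ 2))⁻¹| ≤ ec t ∧
          ∀ k' : Fin 3, |P t (ξ c t) (Rc t) k'.succ - M c * (√(1 - ‖v c t‖ ^ 2))⁻¹ * v c t k'| ≤ ec t) ∧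
        (∀ t, Tc ≤ t → 1 ≤ Rc t ∧ TL ≤ t)) ∧
      ∃ (Cw Tw : ℝ) (ew : ℝ → ℝ), 0 ≤ Cw ∧ Tendsto ew atTop (𝓝 0) ∧ (∀ t, Tw ≤ t → 0 ≤ ew t) ∧
      ∀ (s₁ s₂ : ℝ) (ψ : ℝ → ℝ), Tw ≤ s₁ → s₁ ≤ s₂ →
        (∀ s ∈ Set.Icc s₁ s₂, ∀ s' ∈ Set.Icc s₁ s₂, |ψ s - ψ s'| ≤ 4 * |s - s'|) →
        (∀ s ∈ Set.Icc s₁ s₂, 4 * ‖ξ a s - ξ c s‖ ≤ ψ s ∧ 2 * ‖ξ a s - ξ c s‖ ≤ c₂ * s ∧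
          ∀ l, l ≠ a → l ≠ c → ψ s ≤ ‖ξ l s - ξ a s‖) →
        (∀ μ : Fin 4, |P s₂ (ξ a s₂) (min (ψ s₂ / 2) (c₂ * s₂)) μ -
            P s₁ (ξ a s₁) (min (ψ s₁ / 2) (c₂ * s₁)) μ| ≤
          Cw * (∫ s in s₁..s₂, ((min (ψ s / 2) (c₂ * s)) ^ 2)⁻¹ +
            ((min (ψ s / 2) (c₂ * s)) ^ (7 / 4 : ℝ))⁻¹) + ew s₁) ∧
        (∀ s ∈ Set.Icc s₁ s₂,
          |P s (ξ a s) (min (ψ s / 2) (c₂ * s)) 0 -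
              (M a * (√(1 - ‖v a s‖ ^ 2))⁻¹ + M c * (√(1 - ‖v c s‖ ^ 2))⁻¹)| ≤ ew s ∧
          ∀ k' : Fin 3, |P s (ξ a s) (min (ψ s / 2) (c₂ * s)) k'.succ -
              (M a * (√(1 - ‖v a s‖ ^ 2))⁻¹ * v a s k' +
                M c * (√(1 - ‖v c s‖ ^ 2))⁻¹ * v c s k')| ≤ ew s) := by
  have hdl : ∀ i j s s', TL ≤ s → TL ≤ s' → |‖ξ i s - ξ j s‖ - ‖ξ i s' - ξ j s'‖| ≤ 4 * |s - s'| :=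
    fun i j s s' hs hs' ↦ abs_dist_sub_dist_le (hLip i) (hLip j) hs hs'
  obtain ⟨Ra, hRa⟩ : ∃ f : ℝ → ℝ, ∀ s, f s = min (min ‖ξ b s - ξ a s‖ ‖ξ a s - ξ c s‖ / 3) (c₂ * s) :=
    ⟨_, fun s ↦ rfl⟩
  obtain ⟨Rb, hRb⟩ : ∃ f : ℝ → ℝ, ∀ s, f s = min (min ‖ξ b s - ξ a s‖ ‖ξ b s - ξ c s‖ / 3) (c₂ * s) :=
    ⟨_, fun s ↦ rfl⟩
  obtain ⟨Rc, hRc⟩ : ∃ f : ℝ → ℝ, ∀ s, f s = min (min ‖ξ b s - ξ c s‖ ‖ξ a s - ξ c s‖ / 3) (c₂ * s) :=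
    ⟨_, fun s ↦ rfl⟩
  obtain ⟨hRalip, hRacone, hRainf⟩ := radius_of_two_props hTL0 hc₂ hc₂κ hc₂1 hRa (hdl b a) (hdl a c)
    (hsep b a hab.symm) (hsep a c hac)
  obtain ⟨hRblip, hRbcone, hRbinf⟩ := radius_of_two_props hTL0 hc₂ hc₂κ hc₂1 hRb (hdl b a) (hdl b c)
    (hsep b a hab.symm) (hsep b c hbc)
  obtain ⟨hRclip, hRccone, hRcinf⟩ := radius_of_two_props hTL0 hc₂ hc₂κ hc₂1 hRc (hdl b c) (hdl a c)
    (hsep b c hbc) (hsep a c hac)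
  have hRasep : ∀ s, TL ≤ s → ∀ j, j ≠ a → 3 * Ra s ≤ ‖ξ a s - ξ j s‖ := by
    intro s _ j hj
    rw [hRa]
    have h1 := min_le_left (min ‖ξ b s - ξ a s‖ ‖ξ a s - ξ c s‖ / 3) (c₂ * s)
    rcases h3 j with rfl | rfl | rfl
    · exact (hj rfl).elim
    · rw [norm_sub_rev (ξ a s) (ξ j s)]
      linarith only [h1, min_le_left ‖ξ j s - ξ a s‖ ‖ξ a s - ξ c s‖]
    · linarith only [h1, min_le_right ‖ξ b s - ξ a s‖ ‖ξ a s - ξ j s‖]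
  have hRbsep : ∀ s, TL ≤ s → ∀ j, j ≠ b → 3 * Rb s ≤ ‖ξ b s - ξ j s‖ := by
    intro s _ j hj
    rw [hRb]
    have h1 := min_le_left (min ‖ξ b s - ξ a s‖ ‖ξ b s - ξ c s‖ / 3) (c₂ * s)
    rcases h3 j with rfl | rfl | rfl
    · linarith only [h1, min_le_left ‖ξ b s - ξ j s‖ ‖ξ b s - ξ c s‖]
    · exact (hj rfl).elim
    · linarith only [h1, min_le_right ‖ξ b s - ξ a s‖ ‖ξ b s - ξ j s‖]
  have hRcsep : ∀ s, TL ≤ s → ∀ j, j ≠ c → 3 * Rc s ≤ ‖ξ c s - ξ j s‖ := by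
    intro s _ j hj
    rw [hRc]
    have h1 := min_le_left (min ‖ξ b s - ξ c s‖ ‖ξ a s - ξ c s‖ / 3) (c₂ * s)
    rcases h3 j with rfl | rfl | rfl
    · rw [norm_sub_rev (ξ c s) (ξ j s)]
      linarith only [h1, min_le_right ‖ξ b s - ξ c s‖ ‖ξ j s - ξ c s‖]
    · rw [norm_sub_rev (ξ c s) (ξ j s)]
      linarith only [h1, min_le_left ‖ξ j s - ξ c s‖ ‖ξ a s - ξ c s‖]
    · exact (hj rfl).elim
  refine ⟨Ra, Rb, Rc, hRa, hRb, hRc, ?_, ?_, ?_, ?_⟩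
  · exact singleton_law hκ0 hκ1 hξ hcone hk hslave hW hI a (R := Ra) hRalip hRacone hRasep hRainf
  · exact singleton_law hκ0 hκ1 hξ hcone hk hslave hW hI b (R := Rb) hRblip hRbcone hRbsep hRbinf
  · exact singleton_law hκ0 hκ1 hξ hcone hk hslave hW hI c (R := Rc) hRclip hRccone hRcsep hRcinf
  · exact pair_window_law hκ0 hκ1 hξ hcone hsep hk hslave hW hI hac hc₂ hc₂κ hc₂1

end EscapeLaws

end Summit.FinalStateConjecture.FinalStateConjecture.Theorems.ChargeKinematics

namespace Summit.FinalStateConjecture.FinalStateConjecture.Theorems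

/-- REGISTERED STUB `radius_of_two_props` of the crux item stmt-FinalStateConjecture-10166 (second line lead, line
`old-light-leaves-the-cone`, S4 escape series): the registered one-line signature verbatim, discharged by
`ChargeKinematics.radius_of_two_props`. [folklore] -/
theorem radius_of_two_props : open Literature.Geometry.Lorentzian Filter Topology MeasureTheory intervalIntegral in ∀ {D₁ D₂ R : ℝ → ℝ} {TL c₂ κ : ℝ} (hTL0 : 0 ≤ TL) (hc₂ : 0 < c₂) (hc₂κ : c₂ ≤ (κ - κ ^ 2) / 2) (hc₂1 : c₂ ≤ 1) (hR : ∀ s, R s = min (min (D₁ s) (D₂ s) / 3) (c₂ * s)) (h₁ : ∀ s s', TL ≤ s → TL ≤ s' → |D₁ s - D₁ s'| ≤ 4 * |s - s'|) (h₂ : ∀ s s', TL ≤ s → TL ≤ s' → |D₂ s - D₂ s'| ≤ 4 * |s - s'|) (hi₁ : Tendsto D₁ atTop atTop) (hi₂ : Tendsto D₂ atTop atTop), (∀ s s', TL ≤ s → TL ≤ s' → |R s - R s'| ≤ 2 * |s - s'|) ∧ (∀ s, TL ≤ s → R s ≤ (κ - κ ^ 2) / 2 * s) ∧ Tendsto R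 atTop atTop :=
  @ChargeKinematics.radius_of_two_props

end Summit.FinalStateConjecture.FinalStateConjecture.Theorems

end
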